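import Literature.NumberTheory.Transcendental.FormsAlgebraWedgeProofs
import Literature.LinearAlgebra.Alternating.WedgeOne
import Literature.LinearAlgebra.Alternating.LefschetzCAR
import Mathlib.Analysis.InnerProductSpace.PiL2
import Mathlib.Analysis.InnerProductSpace.Projection.FiniteDimensional
import HarnessLib

/-!
# Pointwise hard Lefschetz: unitary frames, the Kähler form and `L = ω ∧ ·` in CAR form

Linear algebra on a finite-dimensional real inner product space `V` with an **isometric complex
structure** `J` (`J² = -1`, `⟪Jv, Jw⟫ = ⟪v, w⟫`: a tangent space of a Hermitian manifold with its
metric `g` and `J = tangentJ`), completing the pointwise layer of the hard Lefschetz theorem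
(`Literature.AlgebraicGeometry.Motives.hasHardLefschetzProperty_kaehlerClass`, hodge.S14;
C. Voisin, *Hodge Theory and Complex Algebraic Geometry I* (2002), §6.2.1 Lemma 6.20:
"The morphism `Lⁿ⁻ᵏ : Ωᵏ_{X,x} → Ω²ⁿ⁻ᵏ_{X,x}` … is an isomorphism"; D. Huybrechts, *Complex
Geometry* (2005), Prop. 1.2.30) begun in `Literature/LinearAlgebra/Alternating/LefschetzCAR.lean`:

* `exists_unitaryFrame` — **unitary frames exist**: an orthonormal `u₁, …, u_d` with
  `⟪uᵢ, Juⱼ⟫ = 0` and `dim V = 2d` (induction on the dimension, splitting off the `J`-stable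
  plane of a unit vector); `orthonormal_sumElim_unitaryFrame`, `sum_inner_unitaryFrame_smul`
  (Parseval), `covector_eq_sum_unitaryFrame`.
* `alternatizeUncurryFin_lefschetz_eq_sum_wedgeOne` — the alternatization-normalised Lefschetz
  operator `L η = alternatizeUncurryFin (a ↦ ½⟪Ja, ·⟫ ∧ η)` of the Kähler-identity files
  (`KaehlerLefschetzOperatorProofs.lean`, notation `LopE`) is `∑ᵢ ⟪uᵢ, ·⟫ ∧ ⟪Juᵢ, ·⟫ ∧ η`
  (the CAR Lefschetz operator of `LefschetzCAR.lean`).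
* `kaehlerTwoForm_eq_sum_wedgeOne` — the Kähler `2`-form `ω(a, b) = ⟪Ja, b⟫` is
  `∑ᵢ ⟪uᵢ, ·⟫ ∧ ⟪Juᵢ, ·⟫ ∧ 1` (`ω = Σ dxᵢ ∧ dyᵢ`, Voisin §3.1.1);
  `kaehlerTwoForm_wedge_eq_sum_wedgeOne` — `ω ∧ ψ`, for the tree's shuffle wedge
  `ContinuousAlternatingMap.wedge` (reindexed along `2 + l = l + 2`), is the same CAR operator
  (through `wedgeOne_wedge_eq`: `(a ∧ η) ∧ ψ = a ∧ (η ∧ ψ)` for the two wedges, from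
  `alternatizeUncurryFin_wedge_left`). Hence all three Lefschetz operators agree.
* `eq_zero_of_iterate_kaehlerWedge_eq_zero` — **Lemma 6.20, injectivity**: for `k + j = n`
  (`dim V = 2n`) the iterate `(ω ∧ ·)ʲ : Λᵏ → Λ²ⁿ⁻ᵏ` is injective, stated on the `L`-string
  `βᵢ₊₁ = ω ∧ βᵢ`, `βⱼ = 0 → β₀ = 0` (by `eq_zero_of_iterate_lefschetz_eq_zero`: `[L, Λ] = H`
  and the `sl₂`-string argument). Forms take values in any normed commutative `ℝ`-algebra `A`
  (`ℝ` for de Rham cohomology, `ℂ` for the Kähler identities).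

No definitions and no named facts are introduced; casts between degrees are `domDomCongr` along
`finCongr` of explicit equations (never `ℕ`-subtraction).

## References

* C. Voisin, *Hodge Theory and Complex Algebraic Geometry I*, CUP (2002), §3.1.1 (Lemma 3.3,
  unitary coordinates), §6.2.1 (Lemma 6.19, Lemma 6.20). [Voisin2002]
* D. Huybrechts, *Complex Geometry. An Introduction* (2005), Lemma 1.2.17, Prop. 1.2.26,
  Prop. 1.2.30. [Huybrechts2005]
* F. W. Warner, *Foundations of Differentiable Manifolds and Lie Groups* (1983), 2.6, 2.10.
  [Warner1983]
-/

noncomputable section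

open Module Submodule ContinuousAlternatingMap
open scoped InnerProductSpace
open Literature.LinearAlgebra.Alternating

namespace Literature.Geometry.Kaehler

/-- **Unitary frames exist.** On a finite-dimensional real inner product space with an isometric
complex structure `J` (`J² = -1`, `⟪Jv, Jw⟫ = ⟪v, w⟫`) there is an orthonormal family
`u₁, …, u_d` with `⟪uᵢ, J uⱼ⟫ = 0` for all `i, j` and `dim V = 2d`; then `(uᵢ, Juᵢ)ᵢ` is an
orthonormal basis (a unitary frame). Induction on the dimension: split off the `J`-stable plane
`ℝu ⊕ ℝJu` of a unit vector `u` and recurse on its orthogonal complement. (Voisin (2002), §3.1.1;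
Huybrechts (2005), Lemma 1.2.17 / proof of Prop. 1.2.26.) [folklore] -/
theorem exists_unitaryFrame :
    ∀ (n : ℕ) (V : Type*) [NormedAddCommGroup V] [InnerProductSpace ℝ V] [FiniteDimensional ℝ V]
      (J : V →ₗ[ℝ] V), (∀ v, J (J v) = -v) → (∀ v w, ⟪J v, J w⟫_ℝ = ⟪v, w⟫_ℝ) →
      finrank ℝ V = n →
      ∃ (d : ℕ) (u : Fin d → V), n = 2 * d ∧ Orthonormal ℝ u ∧ ∀ i j, ⟪u i, J (u j)⟫_ℝ = 0 := by
  intro n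
  induction n using Nat.strong_induction_on with
  | _ n ih =>
  intro V _ _ _ J hJJ hJ hn
  -- skewness of `J`, and `J` preserves norms
  have hskew : ∀ v w : V, ⟪J v, w⟫_ℝ = -⟪v, J w⟫_ℝ := fun v w ↦ by
    have := hJ v (J w)
    rw [hJJ, inner_neg_right] at this
    linarith
  have hvJv : ∀ v : V, ⟪v, J v⟫_ℝ = 0 := fun v ↦ by
    have h1 := hskew v v
    rw [real_inner_comm] at h1
    linarith
  have hJnorm : ∀ v : V, ‖J v‖ = ‖v‖ := fun v ↦ by
    have h := hJ v v
    rw [real_inner_self_eq_norm_sq, real_inner_self_eq_norm_sq] at h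
    exact (sq_eq_sq₀ (norm_nonneg _) (norm_nonneg _)).1 h
  rcases Nat.eq_zero_or_pos n with h0 | hpos
  · refine ⟨0, Fin.elim0, by omega, ?_, fun i ↦ Fin.elim0 i⟩
    exact orthonormal_iff_ite.2 fun i ↦ Fin.elim0 i
  -- a unit vector `e`, the plane `K = span {e, Je}` and its orthogonal complement `W`
  haveI : Nontrivial V := Module.nontrivial_of_finrank_pos (R := ℝ) (hn ▸ hpos)
  obtain ⟨e, he⟩ : ∃ e : V, ‖e‖ = 1 := exists_norm_eq V zero_le_one
  have hJe : ‖J e‖ = 1 := by rw [hJnorm, he]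
  set b2 : Fin 2 → V := ![e, J e] with hb2
  have hb2on : Orthonormal ℝ b2 := by
    rw [orthonormal_iff_ite]
    intro i j
    fin_cases i <;> fin_cases j
    · simp [hb2, he]
    · simp [hb2, hvJv e]
    · simp [hb2, real_inner_comm, hvJv e]
    · simp [hb2, hJe]
  set K : Submodule ℝ V := span ℝ (Set.range b2) with hK
  have hKfin : finrank ℝ K = 2 := by
    rw [hK, finrank_span_eq_card hb2on.linearIndependent, Fintype.card_fin]
  have heK : e ∈ K := Submodule.subset_span (Set.mem_range_self (0 : Fin 2))
  have hJeK : J e ∈ K := Submodule.subset_span (Set.mem_range_self (1 : Fin 2))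
  set W : Submodule ℝ V := Kᗮ with hW
  have hWfin : finrank ℝ W = n - 2 := by
    have := Submodule.finrank_add_finrank_orthogonal K
    rw [hKfin, hn] at this
    rw [hW]
    omega
  have hmemW : ∀ w : V, w ∈ W ↔ ⟪e, w⟫_ℝ = 0 ∧ ⟪J e, w⟫_ℝ = 0 := by
    intro w
    constructor
    · intro hw
      exact ⟨Submodule.inner_right_of_mem_orthogonal heK hw,
        Submodule.inner_right_of_mem_orthogonal hJeK hw⟩
    · rintro ⟨h1, h2⟩
      rw [hW, Submodule.mem_orthogonal]
      intro k hk
      refine Submodule.span_induction ?_ ?_ ?_ ?_ hk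
      · rintro _ ⟨i, rfl⟩
        fin_cases i
        · exact h1
        · exact h2
      · exact inner_zero_left _
      · intro x y _ _ hx hy; rw [inner_add_left, hx, hy, add_zero]
      · intro a x _ hx; rw [inner_smul_left, hx, mul_zero]
  -- `J` preserves `W`
  have hJW : ∀ w ∈ W, J w ∈ W := by
    intro w hw
    obtain ⟨h1, h2⟩ := (hmemW w).1 hw
    refine (hmemW _).2 ⟨?_, ?_⟩
    · have := hskew e w
      linarith
    · rw [hJ, h1]
  let JW : W →ₗ[ℝ] W := J.restrict hJW
  have hJJW : ∀ w : W, JW (JW w) = -w := fun w ↦ Subtype.ext (hJJ w)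
  have hJW' : ∀ v w : W, ⟪JW v, JW w⟫_ℝ = ⟪v, w⟫_ℝ := fun v w ↦ hJ v w
  -- recurse
  have hn2 : 2 ≤ n := by
    have := Submodule.finrank_le K
    omega
  obtain ⟨d, u, hd, hu, huJ⟩ := ih (n - 2) (by omega) W JW hJJW hJW' hWfin
  refine ⟨d + 1, Fin.cons e (fun i ↦ (u i : V)), by omega, ?_, ?_⟩
  · -- orthonormality of `(e, u₁, …, u_d)`
    rw [orthonormal_iff_ite]
    have hu' := orthonormal_iff_ite.1 hu
    intro i j
    refine Fin.cases ?_ (fun i ↦ ?_) i <;> refine Fin.cases ?_ (fun j ↦ ?_) j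
    · simp [he]
    · simp only [Fin.cons_zero, Fin.cons_succ]
      rw [((hmemW _).1 (u j).2).1, if_neg (Fin.succ_ne_zero j).symm]
    · simp only [Fin.cons_zero, Fin.cons_succ]
      rw [real_inner_comm, ((hmemW _).1 (u i).2).1, if_neg (Fin.succ_ne_zero i)]
    · simp only [Fin.cons_succ, Fin.succ_inj]
      rw [← Submodule.coe_inner, hu' i j]
  · -- `⟪uᵢ, J uⱼ⟫ = 0`
    intro i j
    refine Fin.cases ?_ (fun i ↦ ?_) i <;> refine Fin.cases ?_ (fun j ↦ ?_) j
    · simp [hvJv e]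
    · simp only [Fin.cons_zero, Fin.cons_succ]
      exact ((hmemW _).1 (hJW _ (u j).2)).1
    · simp only [Fin.cons_zero, Fin.cons_succ]
      have h1 : ⟪e, J (u i : V)⟫_ℝ = 0 := ((hmemW _).1 (hJW _ (u i).2)).1
      have h2 := hskew (u i : V) e
      have h3 : ⟪J (u i : V), e⟫_ℝ = 0 := by rw [real_inner_comm]; exact h1
      linarith
    · simp only [Fin.cons_succ]
      exact huJ i j

section UnitaryFrame

variable {V : Type*} [NormedAddCommGroup V] [InnerProductSpace ℝ V] [FiniteDimensional ℝ V]
  (J : V →L[ℝ] V) (hJJ : ∀ v, J (J v) = -v) (hJ : ∀ v w, ⟪J v, J w⟫_ℝ = ⟪v, w⟫_ℝ)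
  {d : ℕ} (u : Fin d → V) (hd : finrank ℝ V = 2 * d) (hu : Orthonormal ℝ u)
  (huJ : ∀ i j, ⟪u i, J (u j)⟫_ℝ = 0)

include hJJ hJ in
omit [FiniteDimensional ℝ V] in
/-- `⟪Jv, w⟫ = -⟪v, Jw⟫` for an isometric complex structure. [folklore] -/
theorem inner_J_left_eq_neg (v w : V) : ⟪J v, w⟫_ℝ = -⟪v, J w⟫_ℝ := by
  have := hJ v (J w)
  rw [hJJ, inner_neg_right] at this
  linarith

include hJJ hJ hu huJ in
omit [FiniteDimensional ℝ V] in
/-- The full frame `(u₁, …, u_d, Ju₁, …, Ju_d)` of a unitary frame is orthonormal. [folklore] -/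
theorem orthonormal_sumElim_unitaryFrame :
    Orthonormal ℝ (Sum.elim u (fun i ↦ J (u i))) := by
  classical
  rw [orthonormal_iff_ite]
  have hu' := orthonormal_iff_ite.1 hu
  rintro (i | i) (j | j)
  · simpa using hu' i j
  · simpa using huJ i j
  · simp only [Sum.elim_inr, Sum.elim_inl, reduceCtorEq, if_false]
    rw [inner_J_left_eq_neg J hJJ hJ, huJ, neg_zero]
  · simpa [hJ] using hu' i j

include hJJ hJ hd hu huJ in
/-- **Parseval for a unitary frame**: `∑ᵢ (⟪uᵢ, w⟫ uᵢ + ⟪Juᵢ, w⟫ Juᵢ) = w`. [folklore] -/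
theorem sum_inner_unitaryFrame_smul (w : V) :
    ∑ i, (⟪u i, w⟫_ℝ • u i + ⟪J (u i), w⟫_ℝ • J (u i)) = w := by
  classical
  have hon := orthonormal_sumElim_unitaryFrame J hJJ hJ u hu huJ
  have hcard : Fintype.card (Fin d ⊕ Fin d) = finrank ℝ V := by
    rw [Fintype.card_sum, Fintype.card_fin, hd, two_mul]
  rcases Nat.eq_zero_or_pos d with hd0 | hd0
  · subst hd0
    haveI : Subsingleton V := Module.finrank_zero_iff.1 (by simpa using hd)
    simp [Subsingleton.elim w 0]
  haveI : Nonempty (Fin d ⊕ Fin d) := ⟨Sum.inl ⟨0, hd0⟩⟩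
  have hsp : (⊤ : Submodule ℝ V) ≤ Submodule.span ℝ (Set.range (Sum.elim u fun i ↦ J (u i))) := by
    rw [← coe_basisOfOrthonormalOfCardEqFinrank hon hcard, Basis.span_eq]
  set b := OrthonormalBasis.mk hon hsp with hb
  have key := b.sum_repr' w
  rw [Fintype.sum_sum_type] at key
  simpa [hb, Finset.sum_add_distrib] using key

include hJJ hJ hd hu huJ in
/-- Expansion of a covector in the dual frame: `ξ = ∑ᵢ (ξ(uᵢ) ⟪uᵢ, ·⟫ + ξ(Juᵢ) ⟪Juᵢ, ·⟫)`.
[folklore] -/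
theorem covector_eq_sum_unitaryFrame (ξ : V →L[ℝ] ℝ) :
    ξ = ∑ i, (ξ (u i) • innerSL ℝ (u i) + ξ (J (u i)) • innerSL ℝ (J (u i))) := by
  ext w
  conv_lhs => rw [← sum_inner_unitaryFrame_smul J hJJ hJ u hd hu huJ w]
  simp [mul_comm]

omit [InnerProductSpace ℝ V] [FiniteDimensional ℝ V] in
/-- `0 ∧ η = 0`. [folklore] -/
theorem wedgeOne_zero_left [NormedSpace ℝ V] {F : Type*} [NormedAddCommGroup F] [NormedSpace ℝ F]
    {n : ℕ} (η : V [⋀^Fin n]→L[ℝ] F) : wedgeOne (0 : V →L[ℝ] ℝ) η = 0 := by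
  ext v; simp [wedgeOne_apply]

omit [InnerProductSpace ℝ V] [FiniteDimensional ℝ V] in
/-- `(∑ᵢ θᵢ) ∧ η = ∑ᵢ θᵢ ∧ η`. [folklore] -/
theorem wedgeOne_sum_left [NormedSpace ℝ V] {ι F : Type*} [NormedAddCommGroup F] [NormedSpace ℝ F]
    {n : ℕ} (s : Finset ι) (θ : ι → V →L[ℝ] ℝ) (η : V [⋀^Fin n]→L[ℝ] F) :
    wedgeOne (∑ i ∈ s, θ i) η = ∑ i ∈ s, wedgeOne (θ i) η := by
  classical
  induction s using Finset.induction_on with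
  | empty => rw [Finset.sum_empty, Finset.sum_empty, wedgeOne_zero_left]
  | insert a s ha ih => rw [Finset.sum_insert ha, Finset.sum_insert ha, wedgeOne_add_left, ih]

include hJJ hJ hd hu huJ in
/-- **The Lefschetz operator in CAR form** (Voisin (2002), §6.2.1; Huybrechts (2005),
Prop. 1.2.26): for the covector family `Θ a = ½ ⟪J a, ·⟫` of a Hermitian inner product (the one
whose alternatization is the Kähler form `ω(a, b) = ⟪J a, b⟫`), the alternatization-normalised
Lefschetz operator `L η = alternatizeUncurryFin (a ↦ Θ a ∧ η)` of
`KaehlerLefschetzOperatorProofs.lean` is `∑ᵢ ⟪uᵢ, ·⟫ ∧ ⟪Juᵢ, ·⟫ ∧ η` in any unitary frame.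
[cite: Voisin2002, §6.2.1] -/
theorem alternatizeUncurryFin_lefschetz_eq_sum_wedgeOne (Θ : V →L[ℝ] V →L[ℝ] ℝ)
    (hΘ : ∀ a b, Θ a b = 2⁻¹ * ⟪J a, b⟫_ℝ) {F : Type*} [NormedAddCommGroup F] [NormedSpace ℝ F]
    {m : ℕ} (η : V [⋀^Fin m]→L[ℝ] F) (Φ : V →L[ℝ] V [⋀^Fin (m + 1)]→L[ℝ] F)
    (hΦ : ∀ a, Φ a = wedgeOne (Θ a) η) :
    alternatizeUncurryFin Φ =
      ∑ i, wedgeOne (innerSL ℝ (u i)) (wedgeOne (innerSL ℝ (J (u i))) η) := by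
  -- expansion of `Θ a` in the dual frame
  have hΘa : ∀ a, Θ a = ∑ i, ((-(2⁻¹ * ⟪J (u i), a⟫_ℝ)) • innerSL ℝ (u i) +
      (2⁻¹ * ⟪u i, a⟫_ℝ) • innerSL ℝ (J (u i))) := by
    intro a
    rw [covector_eq_sum_unitaryFrame J hJJ hJ u hd hu huJ (Θ a)]
    refine Finset.sum_congr rfl fun i _ ↦ ?_
    rw [hΘ, hΘ, hJ, real_inner_comm (u i) a, inner_J_left_eq_neg J hJJ hJ a (u i),
      real_inner_comm (J (u i)) a, mul_neg]
  have hΦ' : Φ = ∑ i, ((-(2⁻¹ : ℝ)) • (innerSL ℝ (J (u i))).smulRight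
      (wedgeOne (innerSL ℝ (u i)) η) + (2⁻¹ : ℝ) • (innerSL ℝ (u i)).smulRight
        (wedgeOne (innerSL ℝ (J (u i))) η)) := by
    refine ContinuousLinearMap.ext fun a ↦ ?_
    rw [hΦ, hΘa, wedgeOne_sum_left, _root_.sum_apply]
    refine Finset.sum_congr rfl fun i _ ↦ ?_
    rw [wedgeOne_add_left, wedgeOne_smul_left, wedgeOne_smul_left]
    simp only [_root_.add_apply, _root_.smul_apply,
      ContinuousLinearMap.smulRight_apply, innerSL_apply_apply, smul_smul, neg_mul]
  rw [hΦ', ← alternatizeUncurryFinCLM_apply, _root_.map_sum]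
  refine Finset.sum_congr rfl fun i _ ↦ ?_
  rw [map_add, map_smul, map_smul, alternatizeUncurryFinCLM_apply, alternatizeUncurryFinCLM_apply]
  change (-(2⁻¹ : ℝ)) • wedgeOne (innerSL ℝ (J (u i))) (wedgeOne (innerSL ℝ (u i)) η) +
    (2⁻¹ : ℝ) • wedgeOne (innerSL ℝ (u i)) (wedgeOne (innerSL ℝ (J (u i))) η) = _
  have hsw := wedgeOne_wedgeOne_add_swap (innerSL ℝ (J (u i))) (innerSL ℝ (u i)) η
  rw [add_eq_zero_iff_eq_neg] at hsw
  rw [hsw, smul_neg, neg_smul, neg_neg, ← add_smul]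
  norm_num

end UnitaryFrame

section KaehlerTwoForm

variable {V : Type*} [NormedAddCommGroup V] [InnerProductSpace ℝ V] [FiniteDimensional ℝ V]
  (J : V →L[ℝ] V) (hJJ : ∀ v, J (J v) = -v) (hJ : ∀ v w, ⟪J v, J w⟫_ℝ = ⟪v, w⟫_ℝ)
  {d : ℕ} (u : Fin d → V) (hd : finrank ℝ V = 2 * d) (hu : Orthonormal ℝ u)
  (huJ : ∀ i j, ⟪u i, J (u j)⟫_ℝ = 0)
  {A : Type*} [NormedCommRing A] [NormedAlgebra ℝ A]

omit [InnerProductSpace ℝ V] [FiniteDimensional ℝ V] in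
/-- `(a ∧ b ∧ c)(p, q) = (a(p) b(q) - a(q) b(p)) c` for covectors `a, b` and a constant `0`-form
`c`. [folklore] -/
theorem wedgeOne_wedgeOne_constOfIsEmpty_apply [NormedSpace ℝ V] (a b : V →L[ℝ] ℝ) (c : A)
    (p q : V) :
    wedgeOne a (wedgeOne b (ContinuousAlternatingMap.constOfIsEmpty ℝ V (Fin 0) c)) ![p, q] =
      (a p * b q - a q * b p) • c := by
  rw [wedgeOne_apply, Fin.sum_univ_two]
  simp only [Fin.val_zero, pow_zero, one_smul, Matrix.cons_val_zero, Fin.val_one, pow_one,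
    Matrix.cons_val_one, neg_smul, one_smul]
  have h0 : Fin.removeNth (0 : Fin 2) ![p, q] = ![q] := by
    ext i; fin_cases i; rfl
  have h1 : Fin.removeNth (1 : Fin 2) ![p, q] = ![p] := by
    ext i; fin_cases i; rfl
  rw [h0, h1, wedgeOne_apply, wedgeOne_apply, Fin.sum_univ_one, Fin.sum_univ_one]
  simp only [Fin.val_zero, pow_zero, one_smul, Matrix.cons_val_zero,
    ContinuousAlternatingMap.constOfIsEmpty_apply, smul_smul, sub_smul]
  ring_nf

include hJJ hJ hd hu huJ in
/-- **The Kähler form in a unitary frame**: the `2`-form `ω(a, b) = ⟪J a, b⟫` (times `1 ∈ A`) is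
`∑ᵢ ⟪uᵢ, ·⟫ ∧ ⟪Juᵢ, ·⟫ ∧ 1` (Voisin (2002), §3.1.1: `ω = Σ dxᵢ ∧ dyᵢ` in unitary coordinates;
Huybrechts (2005), Lemma 1.2.17 ff.). [cite: Voisin2002, §3.1.1] -/
theorem kaehlerTwoForm_eq_sum_wedgeOne (ω : V [⋀^Fin 2]→L[ℝ] A)
    (hω : ∀ a b, ω ![a, b] = algebraMap ℝ A ⟪J a, b⟫_ℝ) :
    ω = ∑ i, wedgeOne (innerSL ℝ (u i))
      (wedgeOne (innerSL ℝ (J (u i))) (ContinuousAlternatingMap.constOfIsEmpty ℝ V (Fin 0) (1 : A))) := by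
  ext v
  have hv : v = ![v 0, v 1] := by
    ext i; fin_cases i <;> rfl
  rw [hv, hω, ContinuousAlternatingMap.sum_apply]
  simp only [wedgeOne_wedgeOne_constOfIsEmpty_apply, innerSL_apply_apply, ← Finset.sum_smul,
    Algebra.algebraMap_eq_smul_one]
  congr 1
  conv_lhs => rw [← sum_inner_unitaryFrame_smul J hJJ hJ u hd hu huJ (v 1)]
  rw [inner_sum]
  refine Finset.sum_congr rfl fun i _ ↦ ?_
  rw [inner_add_right, inner_smul_right, inner_smul_right, hJ, inner_J_left_eq_neg J hJJ hJ (v 0),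
    real_inner_comm (u i) (v 0), real_inner_comm (J (u i)) (v 0)]
  ring

end KaehlerTwoForm

section WedgeBridge

variable {V : Type*} [NormedAddCommGroup V] [NormedSpace ℝ V]
  {A : Type*} [NormedCommRing A] [NormedAlgebra ℝ A] {k l : ℕ}

/-- **`(a ∧ η) ∧ ψ = a ∧ (η ∧ ψ)`**: the wedge with a covector (`wedgeOne`, alternatization
normalisation) and the tree's shuffle wedge `ContinuousAlternatingMap.wedge` associate, up to the
reindexing `(k + l) + 1 = (k + 1) + l` (from the pointwise Leibniz half
`alternatizeUncurryFin_wedge_left`; Warner (1983), 2.6). [cite: Warner1983, 2.6] -/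
theorem wedgeOne_wedge_eq (a : V →L[ℝ] ℝ) (η : V [⋀^Fin k]→L[ℝ] A) (ψ : V [⋀^Fin l]→L[ℝ] A) :
    (wedgeOne a η).wedge ψ =
      (wedgeOne a (η.wedge ψ)).domDomCongr (finCongr (Nat.add_right_comm k 1 l).symm) := by
  have h := Literature.NumberTheory.Transcendental.alternatizeUncurryFin_wedge_left
    (a.smulRight (η.wedge ψ)) (a.smulRight η) ψ
    (fun v ↦ by simp [ContinuousAlternatingMap.wedge_smul_left])
  change wedgeOne a (η.wedge ψ) = ((wedgeOne a η).wedge ψ).domDomCongr _ at h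
  rw [h, ← ContinuousAlternatingMap.domDomCongr_trans, ← finCongr_symm (Nat.add_right_comm k 1 l),
    Equiv.self_trans_symm, ContinuousAlternatingMap.domDomCongr_refl]

/-- `a ∧ ·` commutes with reindexing along an equation of degrees. [folklore] -/
theorem wedgeOne_domDomCongr_finCongr {F : Type*} [NormedAddCommGroup F] [NormedSpace ℝ F]
    {n n' : ℕ} (h : n = n') (a : V →L[ℝ] ℝ) (η : V [⋀^Fin n]→L[ℝ] F) :
    wedgeOne a (η.domDomCongr (finCongr h)) =
      (wedgeOne a η).domDomCongr (finCongr (congrArg (· + 1) h)) := by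
  subst h; rfl

/-- Composition of two reindexings along equations of degrees. [folklore] -/
theorem domDomCongr_finCongr_trans {F : Type*} [NormedAddCommGroup F] [NormedSpace ℝ F]
    {n n' n'' : ℕ} (h₁ : n = n') (h₂ : n' = n'') (η : V [⋀^Fin n]→L[ℝ] F) :
    (η.domDomCongr (finCongr h₁)).domDomCongr (finCongr h₂) =
      η.domDomCongr (finCongr (h₁.trans h₂)) := by
  subst h₁; subst h₂; rfl

/-- Reindexing along `n = n` does nothing. [folklore] -/
theorem domDomCongr_finCongr_self {F : Type*} [NormedAddCommGroup F] [NormedSpace ℝ F]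
    {n : ℕ} (h : n = n) (η : V [⋀^Fin n]→L[ℝ] F) : η.domDomCongr (finCongr h) = η := rfl

/-- `(∑ᵢ αᵢ) ∧ ψ = ∑ᵢ αᵢ ∧ ψ`. [folklore] -/
theorem sum_wedge_left {ι : Type*} (s : Finset ι) (α : ι → V [⋀^Fin k]→L[ℝ] A)
    (ψ : V [⋀^Fin l]→L[ℝ] A) : (∑ i ∈ s, α i).wedge ψ = ∑ i ∈ s, (α i).wedge ψ := by
  classical
  induction s using Finset.induction_on with
  | empty => rw [Finset.sum_empty, Finset.sum_empty, ContinuousAlternatingMap.zero_wedge]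
  | insert a s ha ih =>
    rw [Finset.sum_insert ha, Finset.sum_insert ha, ContinuousAlternatingMap.wedge_add_left, ih]

/-- Reindexing commutes with finite sums. [folklore] -/
theorem domDomCongr_sum {F : Type*} [NormedAddCommGroup F] [NormedSpace ℝ F] {ι ι₁ ι₂ : Type*}
    (σ : ι₁ ≃ ι₂) (s : Finset ι) (α : ι → V [⋀^ι₁]→L[ℝ] F) :
    (∑ i ∈ s, α i).domDomCongr σ = ∑ i ∈ s, (α i).domDomCongr σ := by
  classical
  induction s using Finset.induction_on with
  | empty => rw [Finset.sum_empty, Finset.sum_empty, ContinuousAlternatingMap.domDomCongr_zero]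
  | insert a s ha ih =>
    rw [Finset.sum_insert ha, Finset.sum_insert ha, ContinuousAlternatingMap.domDomCongr_add, ih]

end WedgeBridge

section PointwiseLefschetz

variable {V : Type*} [NormedAddCommGroup V] [InnerProductSpace ℝ V] [FiniteDimensional ℝ V]
  (J : V →L[ℝ] V) (hJJ : ∀ v, J (J v) = -v) (hJ : ∀ v w, ⟪J v, J w⟫_ℝ = ⟪v, w⟫_ℝ)
  {d : ℕ} (u : Fin d → V) (hd : finrank ℝ V = 2 * d) (hu : Orthonormal ℝ u)
  (huJ : ∀ i j, ⟪u i, J (u j)⟫_ℝ = 0)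
  {A : Type*} [NormedCommRing A] [NormedAlgebra ℝ A]

include hJJ hJ hd hu huJ in
/-- **Wedge with the Kähler form in CAR form**: for the `2`-form `ω(a, b) = ⟪J a, b⟫` and any
`l`-form `ψ`, `ω ∧ ψ` (the tree's shuffle wedge, reindexed along `2 + l = l + 2`) equals
`∑ᵢ ⟪uᵢ, ·⟫ ∧ ⟪Juᵢ, ·⟫ ∧ ψ` — the Lefschetz operator `L = ω ∧ ·` of Kähler geometry (Voisin
(2002), §6.2.1) in the CAR calculus. [cite: Voisin2002, §6.2.1] -/
theorem kaehlerTwoForm_wedge_eq_sum_wedgeOne (ω : V [⋀^Fin 2]→L[ℝ] A)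
    (hω : ∀ a b, ω ![a, b] = algebraMap ℝ A ⟪J a, b⟫_ℝ) {l : ℕ} (ψ : V [⋀^Fin l]→L[ℝ] A)
    (h : 2 + l = l + 2) :
    (ω.wedge ψ).domDomCongr (finCongr h) =
      ∑ i, wedgeOne (innerSL ℝ (u i)) (wedgeOne (innerSL ℝ (J (u i))) ψ) := by
  have hω2 := kaehlerTwoForm_eq_sum_wedgeOne J hJJ hJ u hd hu huJ ω hω
  subst hω2
  set one : V [⋀^Fin 0]→L[ℝ] A := ContinuousAlternatingMap.constOfIsEmpty ℝ V (Fin 0) (1 : A)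
  change ((∑ i, wedgeOne (innerSL ℝ (u i)) (wedgeOne (innerSL ℝ (J (u i))) one)).wedge ψ).domDomCongr
    (finCongr h) = _
  rw [sum_wedge_left, domDomCongr_sum]
  refine Finset.sum_congr rfl fun i _ ↦ ?_
  rw [wedgeOne_wedge_eq, wedgeOne_wedge_eq, ContinuousAlternatingMap.constOfIsEmpty_one_wedge]
  simp only [wedgeOne_domDomCongr_finCongr, domDomCongr_finCongr_trans]
  exact domDomCongr_finCongr_self _ _

include hJJ hJ in
/-- **Pointwise hard Lefschetz, injectivity** (Voisin (2002), Lemma 6.20; Huybrechts (2005),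
Prop. 1.2.30 (iv)): on a real inner product space of dimension `2n` with isometric complex
structure `J` and Kähler form `ω(a, b) = ⟪J a, b⟫`, for `k + j = n` the iterated Lefschetz operator
`Lʲ = (ω ∧ ·)ʲ : Λᵏ → Λᵏ⁺²ʲ = Λ²ⁿ⁻ᵏ` is injective — stated for the `L`-string
`βᵢ₊₁ = ω ∧ βᵢ` (shuffle wedge of the tree, reindexed along `2 + (k + 2i) = k + 2(i + 1)`):
`βⱼ = 0 → β₀ = 0`. Proof: in a unitary frame `L` is the CAR Lefschetz operator
(`kaehlerTwoForm_wedge_eq_sum_wedgeOne`), to which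
`Literature.LinearAlgebra.Alternating.eq_zero_of_iterate_lefschetz_eq_zero` (Lemma 6.19 + the
`sl₂`-string argument) applies. [cite: Voisin2002, Lemma 6.20] -/
theorem eq_zero_of_iterate_kaehlerWedge_eq_zero (ω : V [⋀^Fin 2]→L[ℝ] A)
    (hω : ∀ a b, ω ![a, b] = algebraMap ℝ A ⟪J a, b⟫_ℝ) {k j : ℕ}
    (hkj : 2 * (k + j) = finrank ℝ V) (β : (i : ℕ) → V [⋀^Fin (k + 2 * i)]→L[ℝ] A)
    (hβ : ∀ i, β (i + 1) = (ω.wedge (β i)).domDomCongr (finCongr (Nat.add_comm 2 (k + 2 * i))))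
    (hzero : β j = 0) : β 0 = 0 := by
  classical
  obtain ⟨d, u, hd2, hu, huJ0⟩ := exists_unitaryFrame (finrank ℝ V) V (J : V →ₗ[ℝ] V) hJJ hJ rfl
  have huJ : ∀ i j, ⟪u i, J (u j)⟫_ℝ = 0 := fun i j ↦ by simpa using huJ0 i j
  have hd : finrank ℝ V = 2 * d := hd2
  have hkj' : k + j = Fintype.card (Fin d) := by rw [Fintype.card_fin]; omega
  have hu' := orthonormal_iff_ite.1 hu
  refine Literature.LinearAlgebra.Alternating.eq_zero_of_iterate_lefschetz_eq_zero
    (fun i ↦ innerSL ℝ (u i)) (fun i ↦ innerSL ℝ (J (u i))) u (fun i ↦ J (u i))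
    (fun i j ↦ by rw [innerSL_apply_apply, hu' i j])
    (fun i j ↦ by rw [innerSL_apply_apply, hJ, hu' i j])
    (fun i j ↦ by rw [innerSL_apply_apply, huJ])
    (fun i j ↦ by rw [innerSL_apply_apply, inner_J_left_eq_neg J hJJ hJ, huJ, neg_zero])
    ?_ hkj' β (fun i ↦ ?_) hzero
  · ext w
    simp only [_root_.sum_apply, _root_.add_apply, ContinuousLinearMap.smulRight_apply,
      innerSL_apply_apply, ContinuousLinearMap.id_apply]
    exact sum_inner_unitaryFrame_smul J hJJ hJ u hd hu huJ w
  · rw [hβ i]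
    exact kaehlerTwoForm_wedge_eq_sum_wedgeOne J hJJ hJ u hd hu huJ ω hω (β i) _

end PointwiseLefschetz

end Literature.Geometry.Kaehler
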